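import Summits.QuantumFields.YangMills.Theorems.BalabanUVNodesN11NoExpansionGeneralStepCoPHDoor
import Literature.MathematicalPhysics.QuantumFieldTheory.Balaban1983to89.Node00.Record12LocalLawsTwoScale

/-!
# DAG node N11 — ★★★ THE OLD BRANCH ALONG THE ALL-LARGE-FIELD DIAGONAL AT THE DOOR OF node00-def-K0a's CURED WITNESS IS INTEGRABLE (mass preservation through
# the full-bond kernel transports: `integrable_kernelTransport`) — the discharge of the re-typed analytic binder `hIB` of the no-expansion 𝐓-step on the diagonal;
# the binder-free 𝐓-step itself is assembled in `…N11DiagonalStepNoBinders`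

WHY.  dag-n11-d's diagonal 𝐓-step at the door of node00-def-K0a's cured witness (p547792 ∕ `…N11DiagonalOldBranchMeasurable` §5) was left with ONE binder after
g9's measurability discharge: the old-branch sup bound `hCB`, unprovable as typed (it runs through the marginal density of the averaging).  Re-typed to INTEGRABILITY
(`…N11NoExpansionOldBranchIntegrable`), it is dischargeable on the diagonal by MASS PRESERVATION: along the all-large-field history every generation of 11a's
`𝐓_k(s′_k, ∅)` is the FULL-bond restricted kernel transport (no A-bonds) of `ζ_j(T)·w_j(∅,∅,∅)·(previous branch)`; read at the base configuration the weight factor IS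
def-T's resummed step weight `w_j(s′_{j+1})(U, Ū)` (K0a's pin face, `|w| ≤ 1`) and the previous branch reads the base configuration of the fine field (g7's (SL)
locality) — so each generation maps a `dU_j`-integrable function to a `dU_{j+1}`-integrable one (`integrable_kernelTransport` through the full-bond reindexings), starting
from the bounded operand `exp(−g₀⁻²A − E) ≤ e^{−E}`.

WHAT THIS FILE PROVES (0 `sorry`, 0 `def`).  §1 `integrable_kernelRTOfRecord_full` (`N`-generic: 11a's full-bond restricted transport preserves integrability).  §2 at
`θ₀ : Stage13Params`: `operand_local_of_allLarge`, `integrable_tkBranch_zero_of_allLarge`, `tkBranch_succ_baseCfg_eq_kernelRT` (the generation read at the base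
configuration, at the cured weights), ★★★ `integrable_tkBranch_door_of_allLarge` (`∀ j ≤ k ≤ K`, the level-`j` old branch along `s′_k` is `dU_j`-integrable; induction).
The binder-free 𝐓-step (`…N11DiagonalStepNoBinders`) combines §2 with `…N11DiagonalOldBranchMeasurable` (hmB) and `…N11NoExpansionOldBranchIntegrable`.  What is still NOT here: histories with a small-field step (need the A6 inhabitant of (V), `…N11RePinnedParamDefs`, AND a
measurability law for `Sect2.TermValues`, absent from the tree), sequences with `Ω_{k+1}(s′) ≠ ∅` ([III] §3 + Thm 2 proper) — hence N11 is NOT discharged.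
Sources: [III] Theorem 1 p. 262, Theorem p. 245, (3.24)–(3.25) p. 270, (2.20)–(2.23) p. 258, (3.1) p. 264, (1.11) p. 248; [Balaban1985Averaging] (10) p. 19.

HONEST SCOPE.  Helper lane of K1⁷ `stmt-QuantumFields-20542` (dag-n11-d g9); [folklore] measure theory (disintegration along Bałaban's averaging of record, `HaarAC`) over the
tree's OWN kernels and records; nothing of Bałaban's estimates is asserted; no binder of an ACCEPTED theorem is edited (new `_of_integrable` theorems stand beside the
bounded ones); director-ym №186 (1) respected (no value law for `Zh` at `k ≥ 1` is posited).  N11 is NOT discharged; counts unmoved (typed 28∕28 · discharged 5∕27).  One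
finite four-torus programme at fixed `ε = L^{−K}`; NOT ℝ⁴, NOT OS, NOT a mass gap, NOT Clay.
-/

noncomputable section

open MeasureTheory
open scoped BigOperators Matrix.Norms.L2Operator

namespace Summit.QuantumFields.YangMills.Theorems.BalabanUVNodesN11DiagonalBranchIntegrable

open Literature.MathematicalPhysics.QuantumFieldTheory.Balaban1983to89 T4Continuum T4FiniteEpsInhabited Node00 Node00.Tk DagBinding
open B15DeterminingSets
open T4AveragingDisintegration (kernelTransport integrable_kernelTransport)
open BalabanUVNodesN11NoExpansionAllLargeCoP (sect2Operand_CoP_eq_of_allLarge init_allLarge admSOfRecord_init_eq_of_allLarge)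
open BalabanUVNodesN11NoExpansionDiagonalCoPH (sect2Operand_congr_residual)
open BalabanUVNodesN11NoExpansionDiagonalAtZ (tkWeightsOfRecordP_ζ_local)
open BalabanUVNodesN11NoExpansionGeneralStepCoPH (tkWeightsOfRecordP_w_local_of_quad_local)
open BalabanUVNodesN11TkBranchLinearLocal (tkBranchOfRecord_pairCfgAt_eq_baseCfg)

variable (F : T4Family) (N : ℕ) [NeZero N]

/-! ## §1  The restricted kernel transport of record on FULL bond sets preserves integrability (mass preservation) -/

/-- **11a's RESTRICTED KERNEL TRANSPORT OF RECORD ON THE FULL BOND SETS MAPS `dU`-INTEGRABLE FUNCTIONS TO `dV`-INTEGRABLE ONES** (`j < K`): through the reindexings of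
the full bond sets it is the cell's `kernelTransport` along Bałaban's averaging of record, which preserves integrability (`integrable_kernelTransport`, `HaarAC`).
[cite: Balaban1988Convergent, (2.21)–(2.22) p.258, (3.1) p.264; Balaban1985Averaging, (10) p.19] -/
theorem integrable_kernelRTOfRecord_full (K j : ℕ) (hj : j < K) {hdec : DecidableEq (PBond (F.P K) j)}
    (sV : Finset (PBond (F.P K) j)) (hV : ∀ b, b ∈ sV) (sV' : Finset (PBond (F.P K) (j + 1))) (hV' : ∀ b, b ∈ sV')
    (g : (↥sV → SU N) → ℝ) (hg : Integrable (fun U : GaugeField (F.P K) j (SU N) => g (fun b => U b)) (fieldMeasure (F.P K) j (SU N))) :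
    Integrable (fun V : GaugeField (F.P K) (j + 1) (SU N) => kernelRTOfRecord F N K j sV sV' g (fun b => V b)) (fieldMeasure (F.P K) (j + 1) (SU N)) := by
  let e : ↥sV ≃ PBond (F.P K) j := Equiv.subtypeUnivEquiv hV
  let e' : ↥sV' ≃ PBond (F.P K) (j + 1) := Equiv.subtypeUnivEquiv hV'
  let E : (↥sV → SU N) ≃ᵐ GaugeField (F.P K) j (SU N) := MeasurableEquiv.piCongrLeft (fun _ : PBond (F.P K) j => SU N) e
  let E' : (↥sV' → SU N) ≃ᵐ GaugeField (F.P K) (j + 1) (SU N) :=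
    MeasurableEquiv.piCongrLeft (fun _ : PBond (F.P K) (j + 1) => SU N) e'
  have hEs' : ∀ (V : GaugeField (F.P K) (j + 1) (SU N)), E'.symm V = fun b : ↥sV' => V b.1 := fun V => rfl
  have hE : ∀ (y : ↥sV → SU N) (b : PBond (F.P K) j), E y b = y ⟨b, hV b⟩ := fun y b => by
    change E y (e ⟨b, hV b⟩) = y ⟨b, hV b⟩
    exact MeasurableEquiv.piCongrLeft_apply_apply e (β := fun _ : PBond (F.P K) j => SU N) y ⟨b, hV b⟩
  have mpE : MeasurePreserving E (Measure.pi fun _ : ↥sV => (HaarData.haar : Measure (SU N))) (fieldMeasure (F.P K) j (SU N)) := by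
    unfold fieldMeasure
    exact measurePreserving_piCongrLeft (fun _ : PBond (F.P K) j => (HaarData.haar : Measure (SU N))) e
  have mpE' : MeasurePreserving E' (Measure.pi fun _ : ↥sV' => (HaarData.haar : Measure (SU N)))
      (fieldMeasure (F.P K) (j + 1) (SU N)) := by
    unfold fieldMeasure
    exact measurePreserving_piCongrLeft (fun _ : PBond (F.P K) (j + 1) => (HaarData.haar : Measure (SU N))) e'
  have mpEs : MeasurePreserving E.symm (fieldMeasure (F.P K) j (SU N)) (Measure.pi fun _ : ↥sV => (HaarData.haar : Measure (SU N))) :=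
    MeasurePreserving.symm E mpE
  have mpE's : MeasurePreserving E'.symm (fieldMeasure (F.P K) (j + 1) (SU N))
      (Measure.pi fun _ : ↥sV' => (HaarData.haar : Measure (SU N))) :=
    MeasurePreserving.symm E' mpE'
  set μ := fieldMeasure (F.P K) j (SU N) with hμ
  set μ' := fieldMeasure (F.P K) (j + 1) (SU N) with hμ'
  set ν : Measure (↥sV → SU N) := Measure.pi fun _ : ↥sV => (HaarData.haar : Measure (SU N)) with hν
  set ν' : Measure (↥sV' → SU N) := Measure.pi fun _ : ↥sV' => (HaarData.haar : Measure (SU N)) with hν'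
  haveI : IsProbabilityMeasure μ := Missing.isProbabilityMeasure_fieldMeasure (F.P K) j
  set av := (avOfRecord F N K j).avg with hav
  have hmav : Measurable av := avOfRecord_measurable F N K j
  have hac : μ.map av ≪ μ' := avOfRecord_haarAC F N K j hj
  set avg' := avgRestrOfRecord F N K j sV sV' with havg'def
  have havg' : avg' = fun y => E'.symm (av (E y)) := by
    funext y b'
    have hupd : Function.updateFinset (fun _ : PBond (F.P K) j => (1 : SU N)) sV y = E y := by
      funext b
      rw [Function.updateFinset_def]
      simp only [dif_pos (hV b), hE]
    show (avOfRecord F N K j).avg (Function.updateFinset (fun _ => 1) sV y) b' = _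
    rw [hupd, hEs']
  have hmavg' : Measurable avg' := by
    rw [havg']; exact E'.symm.measurable.comp (hmav.comp E.measurable)
  have hac' : ν.map avg' ≪ ν' := by
    rw [havg']
    have h1 : ν.map (fun y => E'.symm (av (E y))) = ((ν.map E).map av).map E'.symm := by
      rw [Measure.map_map hmav E.measurable, Measure.map_map E'.symm.measurable (hmav.comp E.measurable)]
      rfl
    rw [h1, mpE.map_eq, ← mpE's.map_eq]
    exact hac.map E'.symm.measurable
  haveI : IsFiniteMeasure ν := by rw [hν]; infer_instance
  -- `g` is `ν`-integrable (measure preservation of `E`)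
  have hgν : Integrable g ν := by
    refine (mpEs.integrable_comp_emb E.symm.measurableEmbedding).1 (hg.congr (ae_of_all _ fun U => ?_))
    rfl
  -- the kernel transport along `avg′` is `ν′`-integrable, and its pull-back along `E′.symm` is the goal
  have hT : Integrable (kernelTransport ν ν' avg' g) ν' := integrable_kernelTransport ν ν' hmavg' hac' hgν
  have h := (mpE's.integrable_comp_emb E'.symm.measurableEmbedding).2 hT
  refine h.congr (ae_of_all _ fun V => ?_)
  rfl

/-! ## §2  The old branch along the all-large-field diagonal at the door is INTEGRABLE -/

section Diagonal

variable {F N}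
variable (θ₀ : Stage13Params F N) (p : B12.RunParams)

/-- The §2 operand at the door along an all-large history reads scale `0` only (closed form `exp(−g₀⁻²A((ω 0).1) − E)`), hence is `m`-local for every `m`.
[cite: Balaban1988Convergent, (2.23) p.258 (bookkeeping)] -/
theorem operand_local_of_allLarge (hM : 1 ≤ θ₀.τ9.M) {n : ℕ} (s : SeqOfRecord F θ₀.ν θ₀.τ9.M (gOfRecord₁₃ F N θ₀ p) p.K n)
    (hall : ∀ j, 1 ≤ j → j ≤ n → s.Ω j = ∅) (Rz : Sect2.Residual (F.P p.K) (MatA N)) (t : Sect2.TermValues (F.P p.K) (MatA N) (FluctV N) θ₀.τ9.M)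
    (E₀ : ℝ) (S : ℕ → Set (Site (F.P p.K) 0)) (m : ℕ) (ω ω' : MultiCfg (F.P p.K) (SU N) (FluctV N)) (h : ∀ i, i ≤ m → ω i = ω' i) :
    sect2Operand F N (FluctV N) p.K (settingOfRecord₁₃ F N θ₀ p) Rz s t E₀ (UbgOfRecord₁₃CoP F N θ₀ p n s) (S, fun j => (ω j).2) (fun j => (ω j).1) =
      sect2Operand F N (FluctV N) p.K (settingOfRecord₁₃ F N θ₀ p) Rz s t E₀ (UbgOfRecord₁₃CoP F N θ₀ p n s) (S, fun j => (ω' j).2) (fun j => (ω' j).1) := by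
  rw [sect2Operand_congr_residual (settingOfRecord₁₃ F N θ₀ p) Rz (θ₀.Rz p.K) s t E₀ (UbgOfRecord₁₃CoP F N θ₀ p n s),
    sect2Operand_CoP_eq_of_allLarge θ₀ p hM s hall t E₀ _ ω, sect2Operand_CoP_eq_of_allLarge θ₀ p hM s hall t E₀ _ ω', h 0 (Nat.zero_le m)]

/-- **THE LEVEL-0 OLD BRANCH IS INTEGRABLE** (`𝐓_0 = id`; the operand along an all-large history is `exp(−g₀⁻²A − E) ≤ e^{−E}`). [cite: Balaban1988Convergent, (2.20) p.258, (2.23) p.258 (bookkeeping)] -/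
theorem integrable_tkBranch_zero_of_allLarge (hM : 1 ≤ θ₀.τ9.M) {n : ℕ} (s : SeqOfRecord F θ₀.ν θ₀.τ9.M (gOfRecord₁₃ F N θ₀ p) p.K n)
    (hall : ∀ j, 1 ≤ j → j ≤ n → s.Ω j = ∅) (W : TkWeights F N (FluctV N) p.K) (S : ℕ → Set (Site (F.P p.K) 0))
    (Rz : Sect2.Residual (F.P p.K) (MatA N)) (t : Sect2.TermValues (F.P p.K) (MatA N) (FluctV N) θ₀.τ9.M) (E₀ : ℝ) :
    Integrable (fun U : GaugeField (F.P p.K) 0 (SU N) =>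
      tkBranchOfRecord F N (FluctV N) θ₀.ν θ₀.τ9.M _ p.K W s S 0
        (fun ω => sect2Operand F N (FluctV N) p.K (settingOfRecord₁₃ F N θ₀ p) Rz s t E₀ (UbgOfRecord₁₃CoP F N θ₀ p n s) (S, fun i => (ω i).2)
          (fun i => (ω i).1))
        (baseCfg (V := FluctV N) 0 U)) (fieldMeasure (F.P p.K) 0 (SU N)) := by
  haveI : IsProbabilityMeasure (fieldMeasure (F.P p.K) 0 (SU N)) := Missing.isProbabilityMeasure_fieldMeasure (F.P p.K) 0
  have heq : (fun U : GaugeField (F.P p.K) 0 (SU N) =>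
      tkBranchOfRecord F N (FluctV N) θ₀.ν θ₀.τ9.M _ p.K W s S 0
        (fun ω => sect2Operand F N (FluctV N) p.K (settingOfRecord₁₃ F N θ₀ p) Rz s t E₀ (UbgOfRecord₁₃CoP F N θ₀ p n s) (S, fun i => (ω i).2)
          (fun i => (ω i).1))
        (baseCfg (V := FluctV N) 0 U)) =
      fun U => Real.exp (-(1 / (gOfRecord₁₃ F N θ₀ p 0) ^ 2 * wilsonAction4 U) - E₀) := by
    funext U
    rw [tkBranchOfRecord_zero, sect2Operand_congr_residual (settingOfRecord₁₃ F N θ₀ p) Rz (θ₀.Rz p.K) s t E₀ (UbgOfRecord₁₃CoP F N θ₀ p n s),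
      sect2Operand_CoP_eq_of_allLarge θ₀ p hM s hall t E₀]
    have hU : ((baseCfg (V := FluctV N) 0 U) 0).1 = U := funext fun b => Tk.baseCfg_fst_self 0 U b
    rw [hU]
  rw [heq]
  have hmeas : Measurable fun U : GaugeField (F.P p.K) 0 (SU N) => Real.exp (-(1 / (gOfRecord₁₃ F N θ₀ p 0) ^ 2 * wilsonAction4 U) - E₀) :=
    Real.measurable_exp.comp (((measurable_const.mul
      (Missing.measurable_wilsonAction4 (G := SU N) RegularGaugeGroup.measurable_reTr)).neg).sub measurable_const)
  refine (integrable_const (Real.exp (-E₀))).mono' hmeas.aestronglyMeasurable (ae_of_all _ fun U => ?_)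
  rw [Real.norm_eq_abs, abs_of_pos (Real.exp_pos _)]
  refine Real.exp_le_exp.mpr ?_
  have hA : 0 ≤ 1 / (gOfRecord₁₃ F N θ₀ p 0) ^ 2 * wilsonAction4 U := mul_nonneg (by positivity) (wilsonAction4_nonneg _)
  linarith

/-- **THE NO-EXPANSION GENERATION READ AT THE BASE CONFIGURATION, AT THE CURED WEIGHTS**: at a history `s` with `Ω_{j+1}(s) = Λ_{j+1}(s) = ∅` and a branch with
`S_{j+1} = ∅`, for an operand `m`-local with `m = j` and weights `k`-local below `j` (12b locality, `quad ≡ 0`), `𝐓_{j+1}(s,S)Φ` at `baseCfg (j+1) V` IS the full-bond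
restricted transport of `y ↦ w_j(s′_{j+1})(ỹ, avg ỹ)·𝐓_j(s,S)Φ(baseCfg j ỹ)` (`ỹ` the field on all bonds), read at `V` — K0a's pin face + g7's (SL) locality.
[cite: Balaban1988Convergent, (2.20)–(2.22) p.258, (3.24) p.270, (1.11) p.248] -/
theorem tkBranch_succ_baseCfg_eq_kernelRT {n : ℕ} (s : SeqOfRecord F θ₀.ν θ₀.τ9.M (gOfRecord₁₃ F N θ₀ p) p.K n) {j : ℕ} {hdec : DecidableEq (PBond (F.P p.K) j)}
    (hj : j < p.K)
    (hΩ : s.Ω (j + 1) = ∅) (hΛ : s.Λ (j + 1) = ∅) (S : ℕ → Set (Site (F.P p.K) 0)) (hS : S (j + 1) = ∅)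
    (W : TkWeights F N (FluctV N) p.K) (hW : W = WtOfRecord₁₃R F N (Stage13RParams.ofCured F N θ₀) p)
    (hζloc : ∀ i, i < j → ∀ ω ω' : MultiCfg (F.P p.K) (SU N) (FluctV N), (∀ m, m ≤ j → ω m = ω' m) →
      W.ζ i (s.Ω (i + 1))ᶜ ω = W.ζ i (s.Ω (i + 1))ᶜ ω')
    (hwloc : ∀ i, i < j → ∀ ω ω' : MultiCfg (F.P p.K) (SU N) (FluctV N), (∀ m, m ≤ j → ω m = ω' m) →
      W.w i (s.Λ (i + 1)) ((s.Λ (i + 1))ᶜ ∩ s.Ω (i + 1)) (S (i + 1)) ω = W.w i (s.Λ (i + 1)) ((s.Λ (i + 1))ᶜ ∩ s.Ω (i + 1)) (S (i + 1)) ω')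
    {Φ : MultiCfg (F.P p.K) (SU N) (FluctV N) → ℝ} (hΦ : ∀ ω ω' : MultiCfg (F.P p.K) (SU N) (FluctV N), (∀ m, m ≤ j → ω m = ω' m) → Φ ω = Φ ω')
    (V : GaugeField (F.P p.K) (j + 1) (SU N)) :
    tkBranchOfRecord F N (FluctV N) θ₀.ν θ₀.τ9.M _ p.K W s S (j + 1) Φ (baseCfg (V := FluctV N) (j + 1) V) =
      kernelRTOfRecord F N p.K j (genDataOfRecord F N (FluctV N) θ₀.ν θ₀.τ9.M _ p.K W s S j).sV
        (genDataOfRecord F N (FluctV N) θ₀.ν θ₀.τ9.M _ p.K W s S j).sV'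
        (fun y => wOfRecord₉ F N θ₀.toStage9Params p (gOfRecord₁₃ F N θ₀ p) j (seqAllLargeOfRecord F θ₀.ν θ₀.τ9.M (gOfRecord₁₃ F N θ₀ p) p.K (j + 1))
            (Function.updateFinset (fun _ => 1) (genDataOfRecord F N (FluctV N) θ₀.ν θ₀.τ9.M _ p.K W s S j).sV y)
            ((avOfRecord F N p.K j).avg (Function.updateFinset (fun _ => 1) (genDataOfRecord F N (FluctV N) θ₀.ν θ₀.τ9.M _ p.K W s S j).sV y)) *
          tkBranchOfRecord F N (FluctV N) θ₀.ν θ₀.τ9.M _ p.K W s S j Φ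
            (baseCfg (V := FluctV N) j (Function.updateFinset (fun _ => 1) (genDataOfRecord F N (FluctV N) θ₀.ν θ₀.τ9.M _ p.K W s S j).sV y)))
        (fun b => V b.1) := by
  obtain rfl : hdec = fun a b => Classical.propDecidable (a = b) := Subsingleton.elim _ _
  have hk : j ≠ j + 1 := by omega
  rw [tkBranchOfRecord_succ, genOp_genDataOfRecord_of_Omega_empty (FluctV N) θ₀.ν θ₀.τ9.M _ p.K _ s S j
    (hdec := fun a b => Classical.propDecidable (a = b)) hΩ]
  congr 1
  · funext y
    rw [Tk.baseCfg_fst_of_ne (V := FluctV N) hk, baseCfg_snd, hΩ, hΛ, hS, Set.compl_empty, Set.inter_empty]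
    have key : ∀ U' : GaugeField (F.P p.K) j (SU N), W.ζ j Set.univ (pairCfgAt (V := FluctV N) j V U') *
        (W.w j ∅ ∅ ∅ (pairCfgAt (V := FluctV N) j V U') * tkBranchOfRecord F N (FluctV N) θ₀.ν θ₀.τ9.M _ p.K W s S j Φ (pairCfgAt (V := FluctV N) j V U')) =
        wOfRecord₉ F N θ₀.toStage9Params p (gOfRecord₁₃ F N θ₀ p) j (seqAllLargeOfRecord F θ₀.ν θ₀.τ9.M (gOfRecord₁₃ F N θ₀ p) p.K (j + 1)) U'
          ((avOfRecord F N p.K j).avg U') * tkBranchOfRecord F N (FluctV N) θ₀.ν θ₀.τ9.M _ p.K W s S j Φ (baseCfg (V := FluctV N) j U') := by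
      intro U'
      rw [← mul_assoc, tkBranchOfRecord_pairCfgAt_eq_baseCfg θ₀.ν θ₀.τ9.M _ p.K W s S hζloc hwloc hΦ V U']
      congr 1
      subst hW
      exact WtOfRecord₁₃R_ofCured_zetaFactor_pairCfgAt θ₀ p hj V _
    have hpc : ∀ U' : GaugeField (F.P p.K) j (SU N), pairCfgAt (V := FluctV N) j V U' = Function.update (baseCfg (V := FluctV N) (j + 1) V) j (U', 0) :=
      fun _ => rfl
    simp only [hpc] at key
    exact key _
  · funext b
    exact Tk.baseCfg_fst_self (V := FluctV N) (j + 1) V b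

/-- **★★★ THE OLD BRANCH ALONG THE ALL-LARGE-FIELD DIAGONAL AT THE DOOR OF K0a's CURED WITNESS IS INTEGRABLE at every level `j ≤ k ≤ K`**:
`U_j ↦ 𝐓_j(s′_k, ∅)[e^{A_k(s′_k)}](U_j)` is `dU_j`-integrable.  Induction on `j`: level `0` by `integrable_tkBranch_zero_of_allLarge`; at `j + 1` the generation is
the full-bond transport of `w_j(s′_{j+1})(·, avg ·)·(old branch at level j)` (`tkBranch_succ_baseCfg_eq_kernelRT`; `|w| ≤ 1` by row `tstep.absW_le`), which is
integrable by §1 and the induction hypothesis. [cite: Balaban1988Convergent, (2.20)–(2.22) p.258, (3.1) p.264, (3.24) p.270, (1.11) p.248] -/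
theorem integrable_tkBranch_door_of_allLarge (h : θ₀.Provisos₁₃Core F N) (hM : 1 ≤ θ₀.τ9.M) {k : ℕ} (hkK : k ≤ p.K)
    (Rz : Sect2.Residual (F.P p.K) (MatA N)) (t : Sect2.TermValues (F.P p.K) (MatA N) (FluctV N) θ₀.τ9.M) (E₀ : ℝ) :
    ∀ j, j ≤ k → Integrable (fun U : GaugeField (F.P p.K) j (SU N) =>
      tkBranchOfRecord F N (FluctV N) θ₀.ν θ₀.τ9.M _ p.K (WtOfRecord₁₃R F N (Stage13RParams.ofCured F N θ₀) p)
        (seqAllLargeOfRecord F θ₀.ν θ₀.τ9.M (gOfRecord₁₃ F N θ₀ p) p.K k) (fun _ => ∅) j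
        (fun ω => sect2Operand F N (FluctV N) p.K (settingOfRecord₁₃ F N θ₀ p) Rz (seqAllLargeOfRecord F θ₀.ν θ₀.τ9.M (gOfRecord₁₃ F N θ₀ p) p.K k) t E₀
          (UbgOfRecord₁₃CoP F N θ₀ p k (seqAllLargeOfRecord F θ₀.ν θ₀.τ9.M (gOfRecord₁₃ F N θ₀ p) p.K k)) (fun _ => ∅, fun i => (ω i).2)
          (fun i => (ω i).1))
        (baseCfg (V := FluctV N) j U)) (fieldMeasure (F.P p.K) j (SU N)) := by
  intro j
  induction j with
  | zero =>
    intro _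
    exact integrable_tkBranch_zero_of_allLarge θ₀ p hM (seqAllLargeOfRecord F θ₀.ν θ₀.τ9.M (gOfRecord₁₃ F N θ₀ p) p.K k) (fun _ _ _ => rfl) _ _ Rz t E₀
  | succ j ih =>
    intro hjk
    haveI hdec : DecidableEq (PBond (F.P p.K) j) := fun a b => Classical.propDecidable (a = b)
    have hj : j < p.K := lt_of_lt_of_le (Nat.lt_of_succ_le hjk) hkK
    have ihj := ih (Nat.le_of_succ_le hjk)
    have hζloc : ∀ i, i < j → ∀ ω ω' : MultiCfg (F.P p.K) (SU N) (FluctV N), (∀ m, m ≤ j → ω m = ω' m) →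
        (WtOfRecord₁₃R F N (Stage13RParams.ofCured F N θ₀) p).ζ i
            ((seqAllLargeOfRecord F θ₀.ν θ₀.τ9.M (gOfRecord₁₃ F N θ₀ p) p.K k).Ω (i + 1))ᶜ ω =
          (WtOfRecord₁₃R F N (Stage13RParams.ofCured F N θ₀) p).ζ i
            ((seqAllLargeOfRecord F θ₀.ν θ₀.τ9.M (gOfRecord₁₃ F N θ₀ p) p.K k).Ω (i + 1))ᶜ ω' := fun i hi ω ω' hω =>
      (localLaws_ZrOfRecord₁₃ (θ := θ₀) (p := p)).localLaws₂.zeta0_local_lt hi _ ω ω' hω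
    have hwloc : ∀ i, i < j → ∀ ω ω' : MultiCfg (F.P p.K) (SU N) (FluctV N), (∀ m, m ≤ j → ω m = ω' m) →
        (WtOfRecord₁₃R F N (Stage13RParams.ofCured F N θ₀) p).w i ((seqAllLargeOfRecord F θ₀.ν θ₀.τ9.M (gOfRecord₁₃ F N θ₀ p) p.K k).Λ (i + 1))
            (((seqAllLargeOfRecord F θ₀.ν θ₀.τ9.M (gOfRecord₁₃ F N θ₀ p) p.K k).Λ (i + 1))ᶜ ∩
              (seqAllLargeOfRecord F θ₀.ν θ₀.τ9.M (gOfRecord₁₃ F N θ₀ p) p.K k).Ω (i + 1))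
            ((fun _ => (∅ : Set (Site (F.P p.K) 0))) (i + 1)) ω =
          (WtOfRecord₁₃R F N (Stage13RParams.ofCured F N θ₀) p).w i ((seqAllLargeOfRecord F θ₀.ν θ₀.τ9.M (gOfRecord₁₃ F N θ₀ p) p.K k).Λ (i + 1))
            (((seqAllLargeOfRecord F θ₀.ν θ₀.τ9.M (gOfRecord₁₃ F N θ₀ p) p.K k).Λ (i + 1))ᶜ ∩
              (seqAllLargeOfRecord F θ₀.ν θ₀.τ9.M (gOfRecord₁₃ F N θ₀ p) p.K k).Ω (i + 1))
            ((fun _ => (∅ : Set (Site (F.P p.K) 0))) (i + 1)) ω' :=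
      fun i hi ω ω' hω => tkWeightsOfRecordP_w_local_of_quad_local (ZrOfRecord₁₃ F N θ₀ p) hi _ _ _ (fun _ _ _ => rfl) ω ω' hω
    have hstep := fun V => tkBranch_succ_baseCfg_eq_kernelRT θ₀ p (seqAllLargeOfRecord F θ₀.ν θ₀.τ9.M (gOfRecord₁₃ F N θ₀ p) p.K k)
      (hdec := hdec) hj rfl rfl (fun _ => ∅) rfl (WtOfRecord₁₃R F N (Stage13RParams.ofCured F N θ₀) p) rfl hζloc hwloc
      (operand_local_of_allLarge θ₀ p hM (seqAllLargeOfRecord F θ₀.ν θ₀.τ9.M (gOfRecord₁₃ F N θ₀ p) p.K k) (fun _ _ _ => rfl) Rz t E₀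
        (fun _ => ∅) j) V
    -- integrability of the transported function on the fine field: `|w| ≤ 1` times the integrable old branch
    have hsV := mem_sV_of_Omega_empty (FluctV N) θ₀.ν θ₀.τ9.M _ p.K (WtOfRecord₁₃R F N (Stage13RParams.ofCured F N θ₀) p)
      (seqAllLargeOfRecord F θ₀.ν θ₀.τ9.M (gOfRecord₁₃ F N θ₀ p) p.K k) (fun _ => ∅) j (hdec := hdec) rfl
    have hsV' := mem_sV'_of_Omega_empty (FluctV N) θ₀.ν θ₀.τ9.M _ p.K (WtOfRecord₁₃R F N (Stage13RParams.ofCured F N θ₀) p)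
      (seqAllLargeOfRecord F θ₀.ν θ₀.τ9.M (gOfRecord₁₃ F N θ₀ p) p.K k) (fun _ => ∅) j (hdec := hdec) rfl
    have hmw : Measurable fun U : GaugeField (F.P p.K) j (SU N) =>
        wOfRecord₉ F N θ₀.toStage9Params p (gOfRecord₁₃ F N θ₀ p) j (seqAllLargeOfRecord F θ₀.ν θ₀.τ9.M (gOfRecord₁₃ F N θ₀ p) p.K (j + 1))
          U ((avOfRecord F N p.K j).avg U) := by
      have hg : Measurable fun U : GaugeField (F.P p.K) j (SU N) => ((avOfRecord F N p.K j).avg U, U) :=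
        (avOfRecord_measurable F N p.K j).prodMk measurable_id
      simpa only [Function.comp_def] using ((h.tstep p j hj).measW _).comp hg
    have hgU : Integrable (fun U : GaugeField (F.P p.K) j (SU N) =>
        wOfRecord₉ F N θ₀.toStage9Params p (gOfRecord₁₃ F N θ₀ p) j (seqAllLargeOfRecord F θ₀.ν θ₀.τ9.M (gOfRecord₁₃ F N θ₀ p) p.K (j + 1))
            U ((avOfRecord F N p.K j).avg U) *
          tkBranchOfRecord F N (FluctV N) θ₀.ν θ₀.τ9.M _ p.K (WtOfRecord₁₃R F N (Stage13RParams.ofCured F N θ₀) p)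
            (seqAllLargeOfRecord F θ₀.ν θ₀.τ9.M (gOfRecord₁₃ F N θ₀ p) p.K k) (fun _ => ∅) j
            (fun ω => sect2Operand F N (FluctV N) p.K (settingOfRecord₁₃ F N θ₀ p) Rz (seqAllLargeOfRecord F θ₀.ν θ₀.τ9.M (gOfRecord₁₃ F N θ₀ p) p.K k) t E₀
              (UbgOfRecord₁₃CoP F N θ₀ p k (seqAllLargeOfRecord F θ₀.ν θ₀.τ9.M (gOfRecord₁₃ F N θ₀ p) p.K k)) (fun _ => ∅, fun i => (ω i).2)
              (fun i => (ω i).1))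
            (baseCfg (V := FluctV N) j U)) (fieldMeasure (F.P p.K) j (SU N)) := by
      refine ihj.bdd_mul (c := 1) hmw.aestronglyMeasurable (Filter.Eventually.of_forall fun U => ?_)
      rw [Real.norm_eq_abs]
      exact (h.tstep p j hj).absW_le _ U _
    have hI : Integrable (fun V : GaugeField (F.P p.K) (j + 1) (SU N) => kernelRTOfRecord F N p.K j
        (genDataOfRecord F N (FluctV N) θ₀.ν θ₀.τ9.M _ p.K (WtOfRecord₁₃R F N (Stage13RParams.ofCured F N θ₀) p)
          (seqAllLargeOfRecord F θ₀.ν θ₀.τ9.M (gOfRecord₁₃ F N θ₀ p) p.K k) (fun _ => ∅) j).sV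
        (genDataOfRecord F N (FluctV N) θ₀.ν θ₀.τ9.M _ p.K (WtOfRecord₁₃R F N (Stage13RParams.ofCured F N θ₀) p)
          (seqAllLargeOfRecord F θ₀.ν θ₀.τ9.M (gOfRecord₁₃ F N θ₀ p) p.K k) (fun _ => ∅) j).sV'
        (fun y => wOfRecord₉ F N θ₀.toStage9Params p (gOfRecord₁₃ F N θ₀ p) j (seqAllLargeOfRecord F θ₀.ν θ₀.τ9.M (gOfRecord₁₃ F N θ₀ p) p.K (j + 1))
            (Function.updateFinset (fun _ => 1) _ y) ((avOfRecord F N p.K j).avg (Function.updateFinset (fun _ => 1) _ y)) *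
          tkBranchOfRecord F N (FluctV N) θ₀.ν θ₀.τ9.M _ p.K (WtOfRecord₁₃R F N (Stage13RParams.ofCured F N θ₀) p)
            (seqAllLargeOfRecord F θ₀.ν θ₀.τ9.M (gOfRecord₁₃ F N θ₀ p) p.K k) (fun _ => ∅) j
            (fun ω => sect2Operand F N (FluctV N) p.K (settingOfRecord₁₃ F N θ₀ p) Rz (seqAllLargeOfRecord F θ₀.ν θ₀.τ9.M (gOfRecord₁₃ F N θ₀ p) p.K k) t E₀
              (UbgOfRecord₁₃CoP F N θ₀ p k (seqAllLargeOfRecord F θ₀.ν θ₀.τ9.M (gOfRecord₁₃ F N θ₀ p) p.K k)) (fun _ => ∅, fun i => (ω i).2)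
              (fun i => (ω i).1))
            (baseCfg (V := FluctV N) j (Function.updateFinset (fun _ => 1) _ y)))
        (fun b => V b.1)) (fieldMeasure (F.P p.K) (j + 1) (SU N)) :=
      integrable_kernelRTOfRecord_full F N p.K j hj (hdec := hdec) _ hsV _ hsV' _
        (hgU.congr (ae_of_all _ fun U => by simp only [updateFinset_one_restrict_of_forall_mem hsV]))
    exact hI.congr (ae_of_all _ fun V => (hstep V).symm)

end Diagonal

end Summit.QuantumFields.YangMills.Theorems.BalabanUVNodesN11DiagonalBranchIntegrable

end
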